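import Summits.QuantumFields.YangMills.Theorems.BalabanLadderUVTorusClassDefs
import Summits.QuantumFields.YangMills.Theorems.BalabanLadderUVSeamRecStubTransport
import HarnessLib

/-!
# Route `BalabanLadder`, crux `UVOtherGroups` (stmt-QuantumFields-19356): Haar transport of the class-parametric ceilings `MomentBounds6OnSides`

Helper file (`--supports stmt-QuantumFields-19356`, fleet seat `ym-osasm-p2`, director-ym R136 (iii); KNIT 5 «On-variants» of the `SU(N)`-class
transport); pure theorems.  The route owner's ruling on the torus-parity junction (ym-beyond-p2 g20, 2026-08-26T18:15:51Z, adopted direction (c′))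
re-types the Y2 junction currency CLASS-parametrically over raw torus sides; ★ym-osasm-p1 typed the ceilings half as
`Cruxes.UV.TorusClass.MomentBounds6OnSides G r a 𝓣` (`Theorems/BalabanLadderUVTorusClassDefs.lean`, p464599; `= MomentBounds6 G r a` at `𝓣 = {M | Odd M}`,
`momentBounds6OnSides_odd_iff`, p464842).  The `SU(N ≥ 3)` class of the residual leg enters the bridge by HAAR TRANSPORT along `G ≃ₜ* SU(N)`
(`Theorems.UVOtherGroups.legsWitness_of_continuousMulEquiv`, built on `UVSeamRec.Transport.momentBounds6_pull_iff`, p412513's machinery).  This file is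
the transport in the new currency, for EVERY side class `𝓣` and either parity:

* `torusEOn_pull` — the raw-torus expectation of `(G, r₂ ∘ e)` of `Φ ∘ (e ∘ ·)` is that of `(H, r₂)` of `Φ`, on every torus `(ℤ/Mℤ)⁴`
  (push-forward of Wilson's measure, tree `map_wilsonMeasure_of_mulEquiv`, side-generic);
* `torusEOn_plane_pull`, `torusEOn_planeProd_pull` — single-plane fields and their centred products;
* `momentBounds6OnSides_pull_iff` — **`MomentBounds6OnSides G (pull e r₂) a 𝓣 ↔ MomentBounds6OnSides H r₂ a 𝓣`** (same constants, same class);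
* `momentBounds6OnSides_of_continuousMulEquiv` — the ∃-form over `(r, a, 𝓣)` with an arbitrary side condition `S a 𝓣` (unboundedness of `𝓣`,
  positivity ∕ vanishing of `a`, whatever the re-typed item carries) transfers from `H` to every `G ≃ₜ* H`.

So whichever bundle the class-parametric bridge `yangMills_of_legsOn` (KNIT 5 (k3)) consumes, its `SU(N)`-class branch is served from the piece stated AT
`SU(N)` exactly as today (`Theorems/BalabanLadderUVOtherGroupsClasses.lean` §3∕§5).  The floors half `LowerBoundsOnSides` is not yet typed (KNIT 5 k2,
★ym-osasm-p1); its transport will be the same two `simp only` lines over `Q2`∕`Q3` read on raw tori.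
HONEST FRAMING: bookkeeping of a CONDITIONAL chain (0∕6 legs discharged); transport lemmas, no estimate; not a gap, not Clay.
-/

set_option autoImplicit false

noncomputable section

open MeasureTheory Filter Topology
open Literature.MathematicalPhysics.QuantumFieldTheory
open Literature.MathematicalPhysics.QuantumLattice (LGConfig torusLift configShift)
open Summit.QuantumFields.YangMills.Cruxes.OSLegsFromFemtoAndGap.DlrCollarTransfer (plane)
open Summit.QuantumFields.YangMills.Cruxes.UVSeamRec.Transport (cfgMap pull plane_pull)

namespace Summit.QuantumFields.YangMills.Cruxes.UV.TorusClass

section Transport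

variable {G H : Type} [Group G] [TopologicalSpace G] [IsTopologicalGroup G] [CompactSpace G]
  [MeasurableSpace G] [BorelSpace G]
  [Group H] [TopologicalSpace H] [IsTopologicalGroup H] [CompactSpace H]
  [MeasurableSpace H] [BorelSpace H]
  (e : G ≃ₜ* H) (r₂ : LatticeRep H)

/-- **Raw-torus expectations are transported** (every side `M`, either parity): Wilson's measure of `(G, r₂.ρ ∘ e)` on `(ℤ/Mℤ)⁴` pushes forward to
Wilson's measure of `(H, r₂.ρ)` under `U ↦ e ∘ U` (tree `map_wilsonMeasure_of_mulEquiv`), and the periodic lift commutes with that map — the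
side-generic form of `UVSeamRec.Transport.torusE_pull` (which is the case `M = 2L+1`). -/
theorem torusEOn_pull (β : ℝ) (M : ℕ) [NeZero M] (Φ : LGConfig 4 H → ℝ) :
    torusEOn G (pull e r₂) β M (fun U => Φ (cfgMap e U)) = torusEOn H r₂ β M Φ := by
  haveI : SecondCountableTopology H :=
    (r₂.continuous.isClosedEmbedding r₂.injective).isEmbedding.secondCountableTopology
  have he : Continuous e.toMulEquiv := e.continuous_toFun
  have hes : Continuous e.toMulEquiv.symm := e.continuous_invFun
  have hρ : ∀ g, (r₂.ρ.comp e.toMulEquiv.toMonoidHom) g = r₂.ρ (e.toMulEquiv g) := fun g => rfl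
  have hmap := map_wilsonMeasure_of_mulEquiv (d := 4) (ρ := r₂.ρ.comp e.toMulEquiv.toMonoidHom)
    (ρ' := r₂.ρ) e.toMulEquiv he hes hρ β M
  let eM : G ≃ᵐ H := e.toHomeomorph.toMeasurableEquiv
  let E : GaugeConfig 4 M G ≃ᵐ GaugeConfig 4 M H := MeasurableEquiv.piCongrRight fun _ => eM
  have hE : (E : GaugeConfig 4 M G → GaugeConfig 4 M H) = fun U x => e.toMulEquiv (U x) := rfl
  have hpt : ∀ U : GaugeConfig 4 M G, Φ (torusLift M (E U)) = Φ (cfgMap e (torusLift M U)) := fun U => rfl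
  unfold torusEOn
  rw [← hmap, ← hE, integral_map_equiv]
  simp only [hpt]
  rfl

/-- `torusEOn` of a single-plane field is transported. -/
theorem torusEOn_plane_pull (β : ℝ) (M : ℕ) [NeZero M] (q : Fin 4 × Fin 4) (x : Fin 4 → ℤ) :
    torusEOn G (pull e r₂) β M (plane G (pull e r₂) q x) = torusEOn H r₂ β M (plane H r₂ q x) := by
  have h : plane G (pull e r₂) q x = fun U => plane H r₂ q x (cfgMap e U) :=
    funext fun U => plane_pull e r₂ q x U
  rw [h, torusEOn_pull]

/-- `torusEOn` of a centred product of single-plane fields is transported. -/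
theorem torusEOn_planeProd_pull (β : ℝ) (M : ℕ) [NeZero M] (n : ℕ) (q : Fin n → Fin 4 × Fin 4)
    (x : Fin n → (Fin 4 → ℤ)) (c : Fin n → ℝ) :
    torusEOn G (pull e r₂) β M (fun U => ∏ i, (plane G (pull e r₂) (q i) (x i) U - c i)) =
      torusEOn H r₂ β M (fun V => ∏ i, (plane H r₂ (q i) (x i) V - c i)) := by
  simp only [plane_pull]
  exact torusEOn_pull e r₂ β M (fun V => ∏ i, (plane H r₂ (q i) (x i) V - c i))

/-- **`MomentBounds6OnSides` transfers along `e`** — every class of raw sides `𝓣`, any unit map `a`, same constants `C, β₄, ℓ₄`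
(the class-parametric form of `UVSeamRec.Transport.momentBounds6_pull_iff`). -/
theorem momentBounds6OnSides_pull_iff (a : ℝ → ℝ) (𝓣 : Set ℕ) :
    MomentBounds6OnSides G (pull e r₂) a 𝓣 ↔ MomentBounds6OnSides H r₂ a 𝓣 := by
  simp only [MomentBounds6OnSides, torusEOn_plane_pull, torusEOn_planeProd_pull]

include e in
/-- **The ∃-form transfers to every `G ≃ₜ* H`**: if some lattice representation of `H`, unit map `a` and side class `𝓣` satisfy a side
condition `S a 𝓣` (not involving the group) and the class-parametric ceilings, then so do some `(r, a, 𝓣)` for `G` — the representation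
`r₂ ∘ e`, the SAME `a` and `𝓣`.  (`S` is a parameter so that the lemma serves whichever bundle the re-typed item states: `𝓣` unbounded,
`0 < a`, `a → 0`, ….) -/
theorem momentBounds6OnSides_of_continuousMulEquiv (S : (ℝ → ℝ) → Set ℕ → Prop)
    (h : ∃ (r : LatticeRep H) (a : ℝ → ℝ) (𝓣 : Set ℕ), S a 𝓣 ∧ MomentBounds6OnSides H r a 𝓣) :
    ∃ (r : LatticeRep G) (a : ℝ → ℝ) (𝓣 : Set ℕ), S a 𝓣 ∧ MomentBounds6OnSides G r a 𝓣 := by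
  obtain ⟨r₂, a, 𝓣, hS, hM⟩ := h
  exact ⟨pull e r₂, a, 𝓣, hS, (momentBounds6OnSides_pull_iff e r₂ a 𝓣).2 hM⟩

include e in
/-- The ∃-form is INVARIANT under `G ≃ₜ* H` (both directions of `momentBounds6OnSides_of_continuousMulEquiv`). -/
theorem momentBounds6OnSides_witness_iff_of_continuousMulEquiv (S : (ℝ → ℝ) → Set ℕ → Prop) :
    (∃ (r : LatticeRep G) (a : ℝ → ℝ) (𝓣 : Set ℕ), S a 𝓣 ∧ MomentBounds6OnSides G r a 𝓣) ↔
      ∃ (r : LatticeRep H) (a : ℝ → ℝ) (𝓣 : Set ℕ), S a 𝓣 ∧ MomentBounds6OnSides H r a 𝓣 :=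
  ⟨momentBounds6OnSides_of_continuousMulEquiv e.symm S, momentBounds6OnSides_of_continuousMulEquiv e S⟩

end Transport

end Summit.QuantumFields.YangMills.Cruxes.UV.TorusClass

end
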